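import HarnessLib
import Summits.ValiantsHypothesis.ValiantsHypothesis.Theorems.Depth4DoorStrictness
import Summits.ValiantsHypothesis.ValiantsHypothesis.Theorems.Depth4BoundedDoor

/-!
# Strictness of the door arrow, II: the witness and the circuit side (O28)

Completes `Depth4DoorStrictness`: for the explicit homogeneous degree-`n` family `sepPoly K n`
(a product-of-sparse-blocks VARIANT over `N = 2·B·M+1 = 2^{Θ(√n)}` variables, NOT Kumar–Saraf's
`P_{t,n}` / `Q_n` and NOT a p-family) the `BoundedDoor`-SHAPE HOLDS — for every `c`, at
`n = 4^(2c+7)`, NO `ΣΠ^{[c⌊√n⌋+c]}ΣΠ^{[⌊√n⌋]}` expression of top fan-in `(n+2)^(c⌊√n⌋+c)`, over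
any field (`not_hasSPSPExpr_sepPoly`: capped shifted partials, numerics below) — while the
`Depth4HomFour`-SHAPE FAILS: homogeneous `ΣΠΣΠ` circuits of size `≤ (n+2)^(2⌊√n⌋+2)` for EVERY
`n` (`homDepthFourCircuitSize_sepPoly_le`, the tree's `ΣΠΣΠ` builder).  Hence the arrow
`Depth4BoundedDoor.boundedDoor_of_depth4HomFour` is ONE-WAY as a conversion between the two
currencies (`door_arrow_strict`): the door's bottom fan-in is RIGID (`2⌊√n⌋+2 ↦ ⌊√n⌋` turns top
fan-in `1` into super-door).  HONEST LABELS: NOT a rung · 0 S-currency · closes no item · NOT a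
p-family (FORCED: a p-family witness would be an explicit VP lower bound,
`Depth4BoundedDoor.hasSPSPExpr_of_isVPFamily`) · VP ≠ VNP is NOT proved · for per both cells and
the converse of the arrow stay UNDECIDED · KNOWN in spirit and STRONGER in print for p-families at
a fixed exponent (Kumar–Saraf, "The limits of depth reduction for arithmetic formulas",
Thm. 2.3/2.4; Gupta–Kamath–Kayal–Saptharishi 2014 Thm. 1), kernel-new only.  NON-VACUITY: the
witness `n = 4^(2c+7) ≥ 16384` is never a degenerate `n`; at `c = 0` the refuted expression is
`sepPoly = ∏_{j<0} … = 1`, false since `deg sepPoly = n`.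
References: KumarSaraf2015, GuptaKamathKayalSaptharishi2014, Tavenas2015, KumarSaraf2017,
FournierLimayeMalodSrinivasan2015.
-/

set_option linter.dupNamespace false

namespace Summit.ValiantsHypothesis.ValiantsHypothesis.Theorems.Depth4DoorStrictnessCircuit

open MvPolynomial Literature.Computability.AlgebraicComplexity
  Literature.Computability.AlgebraicComplexity.GKKS
  Summit.ValiantsHypothesis.ValiantsHypothesis.Theorems.Depth4DoorStrictness

/-- One Pascal step towards the edge costs at most a factor `2`:
`C(2N+R+1, N+R+1) ≤ 2·C(2N+R, N+R)`. [folklore] -/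
private theorem choose_succ_le (N R : ℕ) :
    (2 * N + R + 1).choose (N + R + 1) ≤ 2 * (2 * N + R).choose (N + R) := by
  refine Nat.le_of_mul_le_mul_right ?_ (Nat.succ_pos (N + R))
  calc (2 * N + R + 1).choose (N + R + 1) * (N + R + 1)
      = (2 * N + R + 1) * (2 * N + R).choose (N + R) := (Nat.add_one_mul_choose_eq _ _).symm
    _ ≤ 2 * (N + R + 1) * (2 * N + R).choose (N + R) := Nat.mul_le_mul_right _ (by omega)
    _ = 2 * (2 * N + R).choose (N + R) * (N + R + 1) := by ring

/-- `C(2N+R, N+R) ≤ 2^R · C(2N, N)`. [folklore] -/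
private theorem choose_add_le (N R : ℕ) :
    (2 * N + R).choose (N + R) ≤ 2 ^ R * (2 * N).choose N := by
  induction R with
  | zero => simp
  | succ R ih =>
    calc (2 * N + (R + 1)).choose (N + (R + 1)) = (2 * N + R + 1).choose (N + R + 1) := by
          rw [← add_assoc, ← add_assoc]
      _ ≤ 2 * (2 ^ R * (2 * N).choose N) := (choose_succ_le N R).trans (Nat.mul_le_mul_left 2 ih)
      _ = 2 ^ (R + 1) * (2 * N).choose N := by ring

/-- One Pascal step towards the centre gains at least a factor `2` while `i ≤ d`:
`2^i · C(2q+d, q) ≤ C(2q+d+i, q+i)`. [folklore] -/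
private theorem two_pow_mul_choose_le (q d : ℕ) :
    ∀ i, i ≤ d → 2 ^ i * (2 * q + d).choose q ≤ (2 * q + d + i).choose (q + i)
  | 0, _ => by simp
  | i + 1, hi => by
    have key : 2 * (2 * q + d + i).choose (q + i) ≤ (2 * q + d + i + 1).choose (q + i + 1) := by
      refine Nat.le_of_mul_le_mul_right ?_ (Nat.succ_pos (q + i))
      calc 2 * (2 * q + d + i).choose (q + i) * (q + i + 1)
          = 2 * (q + i + 1) * (2 * q + d + i).choose (q + i) := by ring
        _ ≤ (2 * q + d + i + 1) * (2 * q + d + i).choose (q + i) :=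
            Nat.mul_le_mul_right _ (by omega)
        _ = (2 * q + d + i + 1).choose (q + i + 1) * (q + i + 1) :=
            Nat.add_one_mul_choose_eq _ _
    calc 2 ^ (i + 1) * (2 * q + d).choose q = 2 * (2 ^ i * (2 * q + d).choose q) := by ring
      _ ≤ 2 * (2 * q + d + i).choose (q + i) :=
          Nat.mul_le_mul_left 2 (two_pow_mul_choose_le q d i (Nat.le_of_succ_le hi))
      _ ≤ (2 * q + d + i + 1).choose (q + i + 1) := key
      _ = (2 * q + d + (i + 1)).choose (q + (i + 1)) := by rw [← add_assoc, ← add_assoc]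

/-- `#{A ⊆ [D] : |A| ≤ k} ≤ 2^D`. [folklore] -/
private theorem numSubsetsLE_le_two_pow (D k : ℕ) : numSubsetsLE D k ≤ 2 ^ D := by
  classical
  unfold numSubsetsLE
  calc _ ≤ (Finset.univ : Finset (Finset (Fin D))).card := Finset.card_filter_le _ _
    _ = 2 ^ D := by rw [Finset.card_univ, Fintype.card_finset, Fintype.card_fin]

/-- `(c+1)² ≤ 4^c`. [folklore] -/
private theorem succ_sq_le_four_pow (c : ℕ) : (c + 1) ^ 2 ≤ 4 ^ c := by
  induction c with
  | zero => simp
  | succ c ih =>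
    calc (c + 1 + 1) ^ 2 ≤ (2 * (c + 1)) ^ 2 := Nat.pow_le_pow_left (by omega) 2
      _ = 4 * (c + 1) ^ 2 := by ring
      _ ≤ 4 * 4 ^ c := Nat.mul_le_mul_left 4 ih
      _ = 4 ^ (c + 1) := by ring

/-- **Expensive side (the `BoundedDoor`-shape HOLDS for `sepPoly`)**: for every `c` there is `n`
(namely `n = 4^(2c+7)`) such that `sepPoly K n` has NO `ΣΠ^{[c⌊√n⌋+c]}ΣΠ^{[⌊√n⌋]}` expression
of top fan-in `(n+2)^(c⌊√n⌋+c)` — over ANY field.  Shift length `ℓ = |Var n|`; the count gives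
`M^B ≤ 2^{D+1} (n+2)^D 2^{B(2B+1)}`, false at that `n`.  Labels: NOT a rung · 0 S-currency ·
NOT a p-family · for per the cell `BoundedDoor` stays UNDECIDED · VP ≠ VNP is NOT proved.
[cite: KumarSaraf2015, cf. Thm. 2.3–2.4; GuptaKamathKayalSaptharishi2014, Thm. 1] -/
theorem not_hasSPSPExpr_sepPoly (K : Type*) [Field K] :
    ∀ c : ℕ, ∃ n : ℕ, ¬ HasSPSPExpr (sepPoly K n) ((n + 2) ^ (c * Nat.sqrt n + c))
      (c * Nat.sqrt n + c) (Nat.sqrt n) := by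
  classical
  intro c
  obtain ⟨B, hB1⟩ : ∃ B : ℕ, 2 ^ (2 * c + 6) = B + 1 :=
    ⟨2 ^ (2 * c + 6) - 1, (Nat.sub_add_cancel Nat.one_le_two_pow).symm⟩
  have h1c : 1 ≤ (c + 1) ^ 2 := Nat.one_le_pow _ _ (Nat.succ_pos c)
  have hB63 : 63 * (c + 1) ^ 2 ≤ B := by
    have hpow : 2 ^ (2 * c + 6) = 4 ^ c * 64 := by
      rw [pow_add 2 (2 * c) 6, pow_mul 2 2 c]; norm_num
    have h4 := succ_sq_le_four_pow c
    omega
  have hB63' : 63 ≤ B := le_trans (Nat.le_mul_of_pos_right 63 h1c) hB63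
  refine ⟨(2 * B + 2) ^ 2, fun h => ?_⟩
  set n := (2 * B + 2) ^ 2 with hn
  have ht : Nat.sqrt n = 2 * B + 2 := by rw [hn]; exact Nat.sqrt_eq' _
  have hBl : blocks n = B := by
    unfold blocks
    rw [ht, hn]
    refine Nat.le_antisymm (Nat.le_of_lt_succ ?_) ?_
    · rw [Nat.div_lt_iff_lt_mul (by omega)]
      nlinarith [Nat.zero_le B]
    · rw [Nat.le_div_iff_mul_le (by omega)]
      nlinarith [Nat.zero_le B]
  have hW : width n = 2 ^ (3 * B + 3) := by
    unfold width
    rw [ht]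
    congr 1
    omega
  rw [ht] at h
  set N := Fintype.card (Var n) with hN
  have hNval : N = 2 * (B * 2 ^ (3 * B + 3)) + 1 := by rw [hN, card_var, hBl, hW]
  set D := c * (2 * B + 2) + c with hD
  -- the sandwich at shift length `ℓ = N`, and the cap count
  have h1 := width_pow_mul_le_of_hasSPSPExpr K N h
  have h2 := card_degLE_le_card_capped_add n N
  -- (`card_degLE, ← hN` FIRST: `Var n` mentions `blocks n`, so `hBl` may only rewrite pure-ℕ spots)
  rw [card_degLE, ← hN, hBl, hW, show 2 * B + 2 - 1 = 2 * B + 1 by omega] at h1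
  rw [card_degLE, card_degLE, ← hN, hBl, hW, ht,
    show 2 * (2 * B + 2) + 1 = 4 * B + 5 by ring] at h2
  have h8 : 8 ≤ 2 ^ (3 * B + 3) :=
    le_trans (by norm_num) (Nat.pow_le_pow_right (by norm_num) (by omega : 3 ≤ 3 * B + 3))
  have hrN : 4 * B + 5 ≤ N := by
    rw [hNval]
    linarith [Nat.mul_le_mul_left B h8, hB63']
  -- cap loss: `C(2N, N) ≤ 2·|capped n N|`
  have hF2 : 2 ^ (4 * B + 5) * (N + (N - (4 * B + 5))).choose (N - (4 * B + 5)) ≤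
      (N + N).choose N := by
    have := two_pow_mul_choose_le (N - (4 * B + 5)) (4 * B + 5) (4 * B + 5) le_rfl
    rwa [show 2 * (N - (4 * B + 5)) + (4 * B + 5) + (4 * B + 5) = N + N by omega,
      show 2 * (N - (4 * B + 5)) + (4 * B + 5) = N + (N - (4 * B + 5)) by omega,
      show N - (4 * B + 5) + (4 * B + 5) = N by omega] at this
  have hBM : 2 * (B * 2 ^ (3 * B + 3)) ≤ 2 ^ (4 * B + 5) := by
    have hB2 : B < 2 ^ B := Nat.lt_two_pow_self
    have h22 : 2 ^ (4 * B + 5) = 2 ^ B * 4 * 2 ^ (3 * B + 3) := by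
      rw [show 4 * B + 5 = B + 2 + (3 * B + 3) by omega, pow_add 2 (B + 2) (3 * B + 3),
        pow_add 2 B 2]
      norm_num
    rw [h22]
    calc 2 * (B * 2 ^ (3 * B + 3)) = (2 * B) * 2 ^ (3 * B + 3) := by ring
      _ ≤ (2 ^ B * 4) * 2 ^ (3 * B + 3) := Nat.mul_le_mul_right _ (by linarith)
  have hCΓ : (N + N).choose N ≤ 2 * (capped n N).card := by
    have h3 : 2 * (B * 2 ^ (3 * B + 3) * (N + (N - (4 * B + 5))).choose (N - (4 * B + 5))) ≤
        (N + N).choose N :=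
      calc 2 * (B * 2 ^ (3 * B + 3) * (N + (N - (4 * B + 5))).choose (N - (4 * B + 5)))
          = 2 * (B * 2 ^ (3 * B + 3)) * (N + (N - (4 * B + 5))).choose (N - (4 * B + 5)) := by
            ring
        _ ≤ 2 ^ (4 * B + 5) * (N + (N - (4 * B + 5))).choose (N - (4 * B + 5)) :=
            Nat.mul_le_mul_right _ hBM
        _ ≤ (N + N).choose N := hF2
    omega
  -- shift loss `C(2N + B(2B+1), N + B(2B+1)) ≤ 2^{B(2B+1)} C(2N, N)` and `ν(D, B) ≤ 2^D`
  have hF1 : (N + (N + B * (2 * B + 1))).choose (N + B * (2 * B + 1)) ≤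
      2 ^ (B * (2 * B + 1)) * (N + N).choose N := by
    have := choose_add_le N (B * (2 * B + 1))
    rwa [show 2 * N + B * (2 * B + 1) = N + (N + B * (2 * B + 1)) by ring, two_mul N] at this
  have hF3 := numSubsetsLE_le_two_pow D B
  have hCpos : 0 < (N + N).choose N := Nat.choose_pos (by omega)
  have h4 : (2 ^ (3 * B + 3)) ^ B ≤ 2 * (n + 2) ^ D * 2 ^ D * 2 ^ (B * (2 * B + 1)) := by
    refine Nat.le_of_mul_le_mul_right ?_ hCpos
    calc (2 ^ (3 * B + 3)) ^ B * (N + N).choose N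
        ≤ (2 ^ (3 * B + 3)) ^ B * (2 * (capped n N).card) := Nat.mul_le_mul_left _ hCΓ
      _ = 2 * ((2 ^ (3 * B + 3)) ^ B * (capped n N).card) := by ring
      _ ≤ 2 * ((n + 2) ^ D * numSubsetsLE D B *
            (N + (N + B * (2 * B + 1))).choose (N + B * (2 * B + 1))) :=
          Nat.mul_le_mul_left 2 h1
      _ ≤ 2 * ((n + 2) ^ D * 2 ^ D * (2 ^ (B * (2 * B + 1)) * (N + N).choose N)) :=
          Nat.mul_le_mul_left 2 (Nat.mul_le_mul (Nat.mul_le_mul_left _ hF3) hF1)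
      _ = 2 * (n + 2) ^ D * 2 ^ D * 2 ^ (B * (2 * B + 1)) * (N + N).choose N := by ring
  -- the exponent comparison: `n + 2 ≤ 2^(4c+15)` and `B = 2^(2c+6) - 1 ≥ 63 (c+1)²`
  have hn2 : n + 2 ≤ 2 ^ (4 * c + 15) := by
    have hp : (B + 1) * (B + 1) = 2 ^ (4 * c + 12) := by
      rw [← hB1, ← pow_add]
      congr 1
      omega
    have hX : 1 ≤ 2 ^ (4 * c + 12) := Nat.one_le_two_pow
    calc n + 2 = 4 * ((B + 1) * (B + 1)) + 2 := by rw [hn]; ring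
      _ ≤ 8 * 2 ^ (4 * c + 12) := by rw [hp]; omega
      _ = 2 ^ (4 * c + 15) := by
          rw [show 4 * c + 15 = 3 + (4 * c + 12) by omega, pow_add 2 3 (4 * c + 12)]
          norm_num
  have hs : (n + 2) ^ D ≤ 2 ^ ((4 * c + 15) * D) := by
    rw [pow_mul]
    exact Nat.pow_le_pow_left hn2 D
  have hexp : 1 + (4 * c + 15) * D + D + B * (2 * B + 1) < (3 * B + 3) * B := by
    rw [hD]
    nlinarith [Nat.mul_le_mul_right B hB63, Nat.mul_le_mul_left (c * c) hB63',
      Nat.mul_le_mul_left c hB63', Nat.zero_le (c * c), Nat.zero_le c, Nat.zero_le B]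
  have h5 : 2 * (n + 2) ^ D * 2 ^ D * 2 ^ (B * (2 * B + 1)) < (2 ^ (3 * B + 3)) ^ B :=
    calc 2 * (n + 2) ^ D * 2 ^ D * 2 ^ (B * (2 * B + 1))
        ≤ 2 * 2 ^ ((4 * c + 15) * D) * 2 ^ D * 2 ^ (B * (2 * B + 1)) :=
          Nat.mul_le_mul_right _ (Nat.mul_le_mul_right _ (Nat.mul_le_mul_left 2 hs))
      _ = 2 ^ (1 + (4 * c + 15) * D + D + B * (2 * B + 1)) := by ring
      _ < 2 ^ ((3 * B + 3) * B) := Nat.pow_lt_pow_right (by norm_num) hexp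
      _ = (2 ^ (3 * B + 3)) ^ B := by rw [pow_mul]
  exact absurd h4 (not_le.2 h5)

/-- **Cheap side, circuit currency**: `sepPoly` has homogeneous `ΣΠΣΠ` circuits of size
`≤ B·M + B + 4 ≤ (n+2)^(2⌊√n⌋+2)` for EVERY `n` (the tree's `ΣΠΣΠ` builder on its one product of
`B+1` sparse pieces); hence the `Depth4HomFour`-shape `∀ c, ∃ n, (n+2)^(c⌊√n⌋+c) < size` FAILS
for `sepPoly` (take `c = 2`). [cite: Tavenas2015, §6, Lemma 3; KumarSaraf2017, §3] -/
theorem homDepthFourCircuitSize_sepPoly_le (K : Type*) [CommSemiring K] (n : ℕ) :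
    homDepthFourCircuitSize (sepPoly K n) ≤ (((n + 2) ^ (2 * Nat.sqrt n + 2) : ℕ) : ℕ∞) := by
  classical
  obtain ⟨Q, U, hprod, hdeg, hsupp, hU⟩ := exists_pieces K n
  have hsum : (∑ _τ : Fin 1, ∏ π : Fin (blocks n + 1), Q π) = sepPoly K n := by
    rw [Fin.sum_univ_one, hprod]
  obtain ⟨C, hCe, hC4, hCh, hCs⟩ := DepthReduction.exists_depthFour_circuit_sum_prod 1
    (blocks n + 1) (fun _ => Q) U (fun _ j => hsupp j) (fun _ j => (hdeg j).imp fun d hd => hd.2)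
    ⟨n, by
      show (∑ _τ : Fin 1, ∏ π : Fin (blocks n + 1), Q π).IsHomogeneous n
      rw [hsum]; exact sepPoly_isHomogeneous K n⟩
  have hcomp : C.Computes (sepPoly K n) := by
    show C.eval = sepPoly K n
    rw [hCe]
    exact hsum
  refine (homDepthFourCircuitSize_le hcomp hC4 hCh).trans ?_
  rw [hCs]
  have hM : width n ≤ 4 ^ Nat.sqrt n := by
    unfold width
    calc 2 ^ (Nat.sqrt n + Nat.sqrt n / 2) ≤ 2 ^ (2 * Nat.sqrt n) :=
          Nat.pow_le_pow_right (by norm_num) (by omega)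
      _ = 4 ^ Nat.sqrt n := by rw [pow_mul]; norm_num
  have hBM : blocks n * width n ≤ n * 4 ^ Nat.sqrt n := Nat.mul_le_mul (Nat.div_le_self _ _) hM
  have hB : blocks n ≤ n := Nat.div_le_self _ _
  have h4 : 1 ≤ 4 ^ Nat.sqrt n := Nat.one_le_pow _ _ (by norm_num)
  have hn4 : n ≤ n * 4 ^ Nat.sqrt n := Nat.le_mul_of_pos_right n h4
  have h16 : 4 ^ Nat.sqrt n ≤ (n + 2) ^ (2 * Nat.sqrt n) := by
    rw [pow_mul]
    exact Nat.pow_le_pow_left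
      (le_trans (by norm_num : 4 ≤ 2 ^ 2) (Nat.pow_le_pow_left (by omega : 2 ≤ n + 2) 2)) _
  have key : U.card + 1 * (blocks n + 1) + 1 + 1 ≤ (n + 2) ^ (2 * Nat.sqrt n + 2) :=
    calc U.card + 1 * (blocks n + 1) + 1 + 1 ≤ n * 4 ^ Nat.sqrt n + n + 4 := by omega
      _ ≤ 4 ^ Nat.sqrt n * (n + 2) ^ 2 := by
          nlinarith [h4, hn4, Nat.zero_le (n * (n * 4 ^ Nat.sqrt n)),
            Nat.zero_le (n * 4 ^ Nat.sqrt n), Nat.zero_le n]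
      _ ≤ (n + 2) ^ (2 * Nat.sqrt n) * (n + 2) ^ 2 := Nat.mul_le_mul_right _ h16
      _ = (n + 2) ^ (2 * Nat.sqrt n + 2) := by rw [← pow_add]
  exact_mod_cast key

/-- **STRICTNESS OF THE DOOR ARROW (O28)**: for the explicit homogeneous degree-`n` family
`sepPoly` the `BoundedDoor`-shape HOLDS and the `Depth4HomFour`-shape FAILS; so
`BoundedDoor-shape ⟹ Depth4HomFour-shape` is FALSE as a conversion between the two currencies
(the arrow `Depth4BoundedDoor.boundedDoor_of_depth4HomFour` is one-way in general; the door's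
bottom fan-in `⌊√n⌋` is rigid).  Labels: NOT a rung · 0 S-currency · closes no item ·
NOT a p-family (forced) · for per NOTHING is decided — both cells and the converse stay
UNDECIDED · VP ≠ VNP is NOT proved. [cite: KumarSaraf2015, cf. Thm. 2.3; Tavenas2015, Thm. 1] -/
theorem door_arrow_strict (K : Type*) [Field K] :
    (∀ c : ℕ, ∃ n : ℕ, ¬ HasSPSPExpr (sepPoly K n) ((n + 2) ^ (c * Nat.sqrt n + c))
      (c * Nat.sqrt n + c) (Nat.sqrt n)) ∧
    ¬ (∀ c : ℕ, ∃ n : ℕ,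
      ((n + 2 : ℕ∞) ^ (c * Nat.sqrt n + c)) < homDepthFourCircuitSize (sepPoly K n)) := by
  refine ⟨not_hasSPSPExpr_sepPoly K, fun h => ?_⟩
  obtain ⟨n, hn⟩ := h 2
  exact absurd hn (not_lt.2 (by exact_mod_cast homDepthFourCircuitSize_sepPoly_le K n))

end Summit.ValiantsHypothesis.ValiantsHypothesis.Theorems.Depth4DoorStrictnessCircuit
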